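import Summits.HodgeConjecture.HodgeConjecture.Theorems.MilnorKExponentialSymbolLiftRCupStep
import Summits.HodgeConjecture.HodgeConjecture.Theorems.MilnorKExponentialSymbolLiftRReduction
import HarnessLib

/-!
# Symbol cocycles are stable under cup product with weight-one symbol cocycles (crux `SymbolLiftR`, line `lefschetz-fold`)

Theorems file of route `MilnorKExponential` of the Hodge summit, crux `SymbolLiftR`
(stmt-HodgeConjecture-18702), line `lefschetz-fold`. The landed cup step `stub_cupStep` (S3) multiplies a
weight-`(q+1)` Milnor symbol cocycle by the weight-one cocycle of THE hyperplane class `h` of a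
hard-Lefschetz datum; its proof uses nothing about `h` except that weight-one cocycle. This file records
the general statement and what it buys the crux unconditionally:

* `hasSymbolCocycle_cup_weightOne` — on a Hodge model `A` whose de Rham comparison is de Rham's
  integration comparison rescaled by `(2πi)^{-k/2}`: if `d ∈ H²` has a weight-one symbol cocycle and
  `c ∈ H^{2(q+1)}` a weight-`(q+1)` symbol cocycle on `A`, then `d ∪ c` has a weight-`(q+2)` symbol cocycle
  on `A` (Čech cup product of the Milnor cocycles on the product cover; product zig-zag; multiplicativity
  of the integration comparison);
* `hasSymbolCocycle_lefschetzPowTo_weightOne` — hence `d^j ∪ c` has a weight-`(q+1+j)` symbol cocycle;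
* `exists_model_symbolCocycles_divisorClosed` — **LIFT on the divisor-generated part, unconditionally**:
  every smooth projective complex `n`-fold, `n ≥ 1`, has ONE Hodge model, symbol-normalised in every
  degree `2(q+1) ≤ 2n`, on which the classes carrying Milnor symbol cocycles contain all rational `(1,1)`
  classes and are closed under sums and under cup product with rational `(1,1)` classes — so every
  `ℤ`-combination of products `d₀ ∪ ⋯ ∪ d_q` of rational `(1,1)` classes is a symbol class of weight
  `q + 1` in the sense of the crux. What is left of `SymbolLiftR` after this is exactly its registered
  kernel `stub_primitiveLift` for classes outside the divisor-generated subalgebra.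

References: R. Bott, L. W. Tu, *Differential Forms in Algebraic Topology* (1982), §8 Prop. 8.8, Thm. 14.28;
F. W. Warner, *Foundations of Differentiable Manifolds and Lie Groups* (1983), Thm. 5.45;
C. Voisin, *Hodge Theory and Complex Algebraic Geometry I* (2002), Thm. 7.10 (proof), Thm. 11.30.
-/

noncomputable section

-- the mandated namespace `Summit.HodgeConjecture.HodgeConjecture.…` repeats a component
set_option linter.dupNamespace false

open scoped Manifold ContDiff

namespace Summit.HodgeConjecture.HodgeConjecture.Theorems.SymbolLiftR

open Literature.AlgebraicGeometry Literature.AlgebraicGeometry.HodgeTheory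
open Literature.Geometry.Kaehler Literature.NumberTheory.Transcendental
open Literature.AlgebraicTopology.SingularHomology

variable {n : ℕ} {X : Motives.SchemeOver ℂ}

open CupStep Literature.AlgebraicGeometry.Modules in
/-- **Symbol cocycles are stable under cup product with weight-one symbol cocycles.** On a Hodge model
`A` of `X` whose de Rham comparison is de Rham's integration comparison rescaled by `(2πi)^{-k/2}`: if
`d ∈ H²(X(ℂ); ℂ)` has a weight-one Milnor symbol cocycle on `A` and `c ∈ H^{2(q+1)}(X(ℂ); ℂ)` a
weight-`(q+1)` one, then `d ∪ c ∈ H^{2(q+2)}(X(ℂ); ℂ)` has a weight-`(q+2)` Milnor symbol cocycle on `A`.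
Proof (verbatim the mechanism of `stub_cupStep`, which is the case `d = h`): on the product of the two
covers, the Čech cup product of the Milnor cocycle of `c` with the weight-one cocycle of `d` is a Milnor
cocycle (`isMilnorSymbolCocycle_cupChain`), its symbol forms are the wedges of the symbol forms
(`symbolForm_mulChain`), the two zig-zags multiply to a zig-zag with bottom `(-1)^{q+1} θ ∧ θ_d`
(`isTransgression_cup`), and `A.deRham[θ ∧ θ_d] = (2πi)^{-(q+2)} e[θ] ∪ e[θ_d] = m m₁ A^*c ∪ A^*d =
m m₁ A^*(d ∪ c)` by the multiplicativity of the integration comparison (Warner Thm. 5.45), graded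
commutativity of `∪` in even degrees and multiplicativity of pull-backs.
[cite: BottTu1982Forms, §8 Prop. 8.8 and Thm. 14.28] [cite: WarnerGTM94, Thm. 5.45] -/
theorem hasSymbolCocycle_cup_weightOne (A : HodgeModel n X)
    (hA : ∀ (k : ℕ) (y : complexDeRhamCohomology A.model A.carrier k),
      A.deRham A.carrier k y = ((2 * (Real.pi : ℂ) * Complex.I) ^ (k / 2))⁻¹ •
        (integrationDeRhamIsoFamily A.model).complexify A.carrier k y)
    {d : complexBetti X (2 * (0 + 1))} (hd : A.HasSymbolCocycle 0 d)
    {q : ℕ} {c : complexBetti X (2 * (q + 1))} (hc : A.HasSymbolCocycle q c) :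
    A.HasSymbolCocycle (q + 1) (cupProduct (two_add_two_mul (q + 1)) d c) := by
  obtain ⟨ι', _, U', hU', hcov', τ, hτ, θh, m₁, hm₁, hTh, hch⟩ := hd
  obtain ⟨ι, _, U, hU, hcov, σ, hσ, θ, m, hm, hT, hcθ⟩ := hc
  -- the product cover
  let V : ι × ι' → Set A.carrier := fun k ↦ U k.1 ∩ U' k.2
  have hV : ∀ k, IsOpen (V k) := fun k ↦ (hU k.1).inter (hU' k.2)
  have hcovV : ∀ x, ∃ k, x ∈ V k := fun x ↦ by
    obtain ⟨i, hi⟩ := hcov x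
    obtain ⟨i', hi'⟩ := hcov' x
    exact ⟨(i, i'), hi, hi'⟩
  have hV₁ : ∀ k, V k ⊆ U k.1 := fun k ↦ Set.inter_subset_left
  have hV₂ : ∀ k, V k ⊆ U' k.2 := fun k ↦ Set.inter_subset_right
  -- the refined cocycles and their cup product
  let σ' : (Fin (q + 2) → ι × ι') → ((Fin (q + 1) → A.carrier → ℂ) →₀ ℤ) := fun J ↦ σ (Prod.fst ∘ J)
  let τ' : (Fin 2 → ι × ι') → ((Fin 1 → A.carrier → ℂ) →₀ ℤ) := fun J ↦ τ (Prod.snd ∘ J)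
  let ρ : (Fin (q + 1 + 2) → ι × ι') → ((Fin (q + 1 + 1) → A.carrier → ℂ) →₀ ℤ) := fun J ↦
    mulChain (q + 1) (σ' (J ∘ Fin.castSucc)) (τ' (Cech.back (q + 1) J))
  have hσ' : IsMilnorSymbolCocycle A.model V σ' := isMilnorSymbolCocycle_comap hσ Prod.fst hV₁
  have hτ' : IsMilnorSymbolCocycle A.model V τ' := isMilnorSymbolCocycle_comap hτ Prod.snd hV₂
  have hρ : IsMilnorSymbolCocycle A.model V ρ := isMilnorSymbolCocycle_cupChain hσ' hτ'
  -- the refined transgressions and their product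
  have hθsc := (mem_cclosedSmoothForms_iff _).1 θ.2
  have hT₁ : IsTransgression hV q (fun J ↦ symbolForm A.model (q + 1) (σ' J))
      (θ : MForm 𝓘(ℝ, A.model) A.carrier ℂ (2 * q + 1 + 1)) :=
    isTransgression_comap hV hT Prod.fst hV₁
  have hT₂ : IsTransgression hV 0 (fun J ↦ symbolForm A.model (0 + 1) (τ' J))
      (θh : MForm 𝓘(ℝ, A.model) A.carrier ℂ (2 * 0 + 1 + 1)) :=
    isTransgression_comap hV hTh Prod.snd hV₂
  have hT₃ := isTransgression_cup hV hT₁ hT₂ hθsc.1 hθsc.2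
  let θ₂ : MForm 𝓘(ℝ, A.model) A.carrier ℂ (2 * (q + 1) + 1 + 1) :=
    (-1 : ℝ) ^ (q + 1) • (θ : MForm 𝓘(ℝ, A.model) A.carrier ℂ (2 * q + 1 + 1)).wedge
      (θh : MForm 𝓘(ℝ, A.model) A.carrier ℂ (2 * 0 + 1 + 1))
  have hT₄ : IsTransgression hV (q + 1) (fun J ↦ symbolForm A.model (q + 1 + 1) (ρ J)) θ₂ :=
    isTransgression_congr_top hV hT₃ fun J z _ ↦ by
      change ((symbolForm A.model (q + 1) (σ' (J ∘ Fin.castSucc))).wedge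
        (symbolForm A.model 1 (τ' (Cech.back (q + 1) J)))) z =
        symbolForm A.model (q + 1 + 1)
          (mulChain (q + 1) (σ' (J ∘ Fin.castSucc)) (τ' (Cech.back (q + 1) J))) z
      rw [symbolForm_mulChain]
  -- the bottom form is closed and smooth (the product cover covers)
  have hθ₂mem : θ₂ ∈ cclosedSmoothForms A.model A.carrier (2 * (q + 1) + 1 + 1) := by
    rw [mem_cclosedSmoothForms_iff]
    exact ⟨hT₄.isSmoothForm hcovV, hT₄.isClosedForm hcovV⟩
  refine ⟨ι × ι', inferInstance, V, hV, hcovV, ρ, hρ, ⟨θ₂, hθ₂mem⟩,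
    (-1) ^ (q + 1) * m * m₁, mul_ne_zero (mul_ne_zero (pow_ne_zero _ (by norm_num)) hm) hm₁, hT₄, ?_⟩
  -- the comparison: multiplicativity of the integration comparison
  haveI : WedgeFacts 𝓘(ℝ, A.model) A.carrier ℝ :=
    wedgeFacts_of_assoc 𝓘(ℝ, A.model) A.carrier ℝ (ContinuousAlternatingMap.WedgeAssoc_holds ℝ A.model ℝ)
  haveI : WedgeFacts 𝓘(ℝ, A.model) A.carrier ℂ :=
    wedgeFacts_of_assoc 𝓘(ℝ, A.model) A.carrier ℂ (ContinuousAlternatingMap.WedgeAssoc_holds ℝ A.model ℂ)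
  have h2πi : (2 * (Real.pi : ℂ) * Complex.I) ≠ 0 :=
    mul_ne_zero (mul_ne_zero two_ne_zero (Complex.ofReal_ne_zero.2 Real.pi_ne_zero)) Complex.I_ne_zero
  let e := (integrationDeRhamIsoFamily A.model).complexify
  have hA' : ∀ (k : ℕ) (y : complexDeRhamCohomology A.model A.carrier k), A.deRham A.carrier k y =
      ((2 * (Real.pi : ℂ) * Complex.I) ^ (k / 2))⁻¹ • e A.carrier k y := hA
  have he : (integrationDeRhamIsoFamily A.model).IsMultiplicative :=
    integrationDeRhamIsoFamily_isMultiplicative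
  have hθe : e A.carrier (2 * q + 1 + 1) (complexDeRhamCohomology.mk A.model A.carrier (2 * q + 1 + 1) θ) =
      (2 * (Real.pi : ℂ) * Complex.I) ^ (q + 1) • (m : ℂ) • A.pullback (2 * q + 1 + 1) c := by
    have h := hA' (2 * q + 1 + 1) (complexDeRhamCohomology.mk A.model A.carrier (2 * q + 1 + 1) θ)
    rw [hcθ, show (2 * q + 1 + 1) / 2 = q + 1 by omega] at h
    exact (inv_smul_eq_iff₀ (pow_ne_zero _ h2πi)).1 h.symm
  have hθhe : e A.carrier (2 * 0 + 1 + 1)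
      (complexDeRhamCohomology.mk A.model A.carrier (2 * 0 + 1 + 1) θh) =
      (2 * (Real.pi : ℂ) * Complex.I) ^ 1 • (m₁ : ℂ) • A.pullback (2 * 0 + 1 + 1) d := by
    have h := hA' (2 * 0 + 1 + 1) (complexDeRhamCohomology.mk A.model A.carrier (2 * 0 + 1 + 1) θh)
    rw [hch, show (2 * 0 + 1 + 1) / 2 = 1 from rfl] at h
    exact (inv_smul_eq_iff₀ (pow_ne_zero _ h2πi)).1 h.symm
  have hmem' : (θ : MForm 𝓘(ℝ, A.model) A.carrier ℂ (2 * q + 1 + 1)).wedge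
      (θh : MForm 𝓘(ℝ, A.model) A.carrier ℂ (2 * 0 + 1 + 1)) ∈
        cclosedSmoothForms A.model A.carrier (2 * (q + 1) + 1 + 1) :=
    wedge_mem_cclosedSmoothForms θ.2 θh.2
  have hdeg₁ : 2 * q + 1 + 1 + (2 * 0 + 1 + 1) = 2 * (q + 1) + 1 + 1 := rfl
  have hdeg₂ : 2 * 0 + 1 + 1 + (2 * q + 1 + 1) = 2 * (q + 1) + 1 + 1 := by omega
  have hmul : e A.carrier (2 * (q + 1) + 1 + 1)
      (complexDeRhamCohomology.mk A.model A.carrier (2 * (q + 1) + 1 + 1) ⟨_, hmem'⟩) =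
      cupProduct hdeg₁
        (e A.carrier (2 * q + 1 + 1) (complexDeRhamCohomology.mk A.model A.carrier (2 * q + 1 + 1) θ))
        (e A.carrier (2 * 0 + 1 + 1) (complexDeRhamCohomology.mk A.model A.carrier (2 * 0 + 1 + 1) θh)) :=
    complexifyFun_mk_wedge he θ θh
  have hθ₂eq : (⟨θ₂, hθ₂mem⟩ : cclosedSmoothForms A.model A.carrier (2 * (q + 1) + 1 + 1)) =
      ((-1 : ℂ) ^ (q + 1)) • (⟨_, hmem'⟩ : cclosedSmoothForms A.model A.carrier (2 * (q + 1) + 1 + 1)) := by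
    apply Subtype.ext
    rw [Submodule.coe_smul]
    change ((-1 : ℝ) ^ (q + 1) • (θ : MForm 𝓘(ℝ, A.model) A.carrier ℂ (2 * q + 1 + 1)).wedge
      (θh : MForm 𝓘(ℝ, A.model) A.carrier ℂ (2 * 0 + 1 + 1))) =
      ((-1 : ℂ) ^ (q + 1)) • (θ : MForm 𝓘(ℝ, A.model) A.carrier ℂ (2 * q + 1 + 1)).wedge
        (θh : MForm 𝓘(ℝ, A.model) A.carrier ℂ (2 * 0 + 1 + 1))
    rw [← algebraMap_smul ℂ ((-1 : ℝ) ^ (q + 1)), map_pow, map_neg, map_one]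
  have hpull : A.pullback (2 * (q + 1) + 1 + 1) (cupProduct (two_add_two_mul (q + 1)) d c) =
      cupProduct hdeg₂ (A.pullback (2 * 0 + 1 + 1) d) (A.pullback (2 * q + 1 + 1) c) :=
    cupProduct_map _ _ _ _
  rw [hθ₂eq, map_smul, map_smul, hA', show (2 * (q + 1) + 1 + 1) / 2 = q + 1 + 1 by omega, hmul, hθe, hθhe]
  simp only [map_smul, LinearMap.smul_apply, smul_smul]
  rw [hpull, cupProduct_gradedComm_holds ℂ A.carrier hdeg₁ hdeg₂
    (A.pullback (2 * q + 1 + 1) c) (A.pullback (2 * 0 + 1 + 1) d), smul_smul]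
  congr 1
  rw [show (2 * q + 1 + 1) * (2 * 0 + 1 + 1) = 2 * (2 * q + 2) by ring, pow_mul, neg_one_sq, one_pow, mul_one]
  push_cast
  field_simp
  ring

/-- **Powers of a weight-one symbol class act on symbol cocycles**: on a rescaled integration model `A`,
if `d ∈ H²` has a weight-one symbol cocycle and `c ∈ H^{2(q+1)}` a weight-`(q+1)` one, then
`d^j ∪ c = L_d^j c ∈ H^{2(q+1)+2j}` has a weight-`(q+1+j)` symbol cocycle on `A` (iterate
`hasSymbolCocycle_cup_weightOne` along `lefschetzPowTo_succ_apply`). [cite: BottTu1982Forms, Thm. 14.28] -/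
theorem hasSymbolCocycle_lefschetzPowTo_weightOne (A : HodgeModel n X)
    (hA : ∀ (k : ℕ) (y : complexDeRhamCohomology A.model A.carrier k),
      A.deRham A.carrier k y = ((2 * (Real.pi : ℂ) * Complex.I) ^ (k / 2))⁻¹ •
        (integrationDeRhamIsoFamily A.model).complexify A.carrier k y)
    {d : complexBetti X (2 * (0 + 1))} (hd : A.HasSymbolCocycle 0 d)
    {q : ℕ} {c : complexBetti X (2 * (q + 1))} (hc : A.HasSymbolCocycle q c) (j : ℕ) :
    A.HasSymbolCocycle (q + j)
      (lefschetzPowTo d j (2 * (q + 1)) (2 * (q + j + 1)) (by ring) c) := by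
  induction j with
  | zero =>
    rw [lefschetzPowTo_zero_apply]
    exact hc
  | succ j ih =>
    have hm' : 2 * (q + 1) + 2 * j = 2 * (q + j + 1) := by ring
    have hm : 2 * (q + 1) + 2 * (j + 1) = 2 * (q + j + 1 + 1) := by ring
    change A.HasSymbolCocycle (q + j + 1) (lefschetzPowTo d (j + 1) (2 * (q + 1)) (2 * (q + j + 1 + 1)) hm c)
    rw [lefschetzPowTo_succ_apply d j (2 * (q + 1)) (2 * (q + j + 1)) (2 * (q + j + 1 + 1)) hm' hm
      (two_add_two_mul (q + j + 1)) c, lefschetzOperator_apply]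
    exact hasSymbolCocycle_cup_weightOne A hA hd ih

/-- **LIFT on the divisor-generated part of the Hodge ring, unconditionally.** Every smooth projective
complex `n`-fold `X`, `n ≥ 1`, has a Hodge model `A` (the `(2πi)^{-k/2}`-rescaled integration model of
`stub_weightOneModel`) which is symbol-normalised in every degree `2(q+1) ≤ 2n`
(`stub_powerNormalisation`) and on which the classes carrying Milnor symbol cocycles
(i) contain every rational class of Hodge type `(1,1)` (Lefschetz `(1,1)` in symbol form),
(ii) are closed under sums in each weight (`stub_add`), and
(iii) are closed under cup product with every rational `(1,1)` class, the weight going up by one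
(`hasSymbolCocycle_cup_weightOne`). Consequently every `ℤ`-combination of products `d₀ ∪ ⋯ ∪ d_q` of
rational `(1,1)` classes, `q + 1 ≤ n`, satisfies the conclusion of the crux `SymbolLiftR` on this one
model; the crux's remaining content is its registered kernel `stub_primitiveLift` for classes outside the
divisor-generated subalgebra. [cite: VoisinHodgeI2002, Thm. 7.10 (proof) and Thm. 11.30] -/
theorem exists_model_symbolCocycles_divisorClosed (hX : Motives.IsSmoothProjective n X) (hn : 1 ≤ n) :
    ∃ A : HodgeModel n X,
      (∀ q : ℕ, q + 1 ≤ n → A.IsSymbolNormalized q) ∧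
      (∀ d : complexBetti X (2 * (0 + 1)), IsRationalClass d →
        IsOfHodgeType n X (2 * (0 + 1)) (0 + 1) (0 + 1) d → A.HasSymbolCocycle 0 d) ∧
      (∀ (q : ℕ) (c c' : complexBetti X (2 * (q + 1))),
        A.HasSymbolCocycle q c → A.HasSymbolCocycle q c' → A.HasSymbolCocycle q (c + c')) ∧
      (∀ d : complexBetti X (2 * (0 + 1)), IsRationalClass d →
        IsOfHodgeType n X (2 * (0 + 1)) (0 + 1) (0 + 1) d →
        ∀ (q : ℕ) (c : complexBetti X (2 * (q + 1))), A.HasSymbolCocycle q c →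
          A.HasSymbolCocycle (q + 1) (cupProduct (two_add_two_mul (q + 1)) d c)) := by
  obtain ⟨A, hA, hone⟩ := stub_weightOneModel hX hn
  exact ⟨A, fun q hq ↦ stub_powerNormalisation hX A hA q hq, hone, fun q c c' ↦ stub_add A q c c',
    fun d hd hdT q c hc ↦ hasSymbolCocycle_cup_weightOne A hA (hone d hd hdT) hc⟩

/-- STUB `stub_cupWeightOne` (registered helper edge of item stmt-HodgeConjecture-18702, line
`lefschetz-fold`, anchoring this file for `--supports`): `hasSymbolCocycle_cup_weightOne` with all
arguments explicit — on a rescaled integration model, cup product with a weight-one symbol class carries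
weight-`(q+1)` symbol cocycles to weight-`(q+2)` symbol cocycles. [cite: BottTu1982Forms, §8 Prop. 8.8 and Thm. 14.28] -/
theorem stub_cupWeightOne : ∀ ⦃n : ℕ⦄ ⦃X : Motives.SchemeOver ℂ⦄ (A : HodgeModel n X), (∀ (k : ℕ) (y : complexDeRhamCohomology A.model A.carrier k), A.deRham A.carrier k y = ((2 * (Real.pi : ℂ) * Complex.I) ^ (k / 2))⁻¹ • (integrationDeRhamIsoFamily A.model).complexify A.carrier k y) → ∀ (d : complexBetti X (2 * (0 + 1))), A.HasSymbolCocycle 0 d → ∀ (q : ℕ) (c : complexBetti X (2 * (q + 1))), A.HasSymbolCocycle q c → A.HasSymbolCocycle (q + 1) (Literature.AlgebraicTopology.SingularHomology.cupProduct (two_add_two_mul (q + 1)) d c) :=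
  fun _ _ A hA _ hd _ _ hc ↦ hasSymbolCocycle_cup_weightOne A hA hd hc

end Summit.HodgeConjecture.HodgeConjecture.Theorems.SymbolLiftR

end
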